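import Mathlib
import HarnessLib
import Literature.Analysis.FluidPDE.SuitableWeak
import Literature.Analysis.FluidPDE.SelfSimilar
import Literature.Analysis.FluidPDE.LocalTypeI
import Literature.Analysis.FluidPDE.SpaceTimeRescaling
import Literature.Analysis.FluidPDE.LocalTypeIScaling
import Literature.Analysis.FluidPDE.LocalTypeICongr
import Literature.Analysis.FluidPDE.LocalTypeIReverseZoom
import Literature.Analysis.FluidPDE.SlabTypeICompactness
import Literature.Analysis.FluidPDE.TypeIRateOseenMildRepresentative
import Summits.NavierStokesRegularity.NavierStokesRegularity.Theorems.RellichScarApexLocalisationSpherePersistence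
import Summits.NavierStokesRegularity.NavierStokesRegularity.Theorems.RellichScarApexLocalisationBetOptimality
import Summits.NavierStokesRegularity.NavierStokesRegularity.Theses.RellichScar

/-!
# `RellichScar.ApexLocalisation` ⇔ final-slice sparsity (line decaying-ancient-bridge v3, lead c1's reduction)

Crux `Summit.NavierStokesRegularity.NavierStokesRegularity.Theses.RellichScar.ApexLocalisation`
(stmt-NavierStokesRegularity-11719). With the four known stubs of skeleton v3 LANDED
(`stub_spherePersistence` p98392, `stub_finalSliceNull` p98775, `stub_movingCentrePersistence`
p98613, `stub_onionShells` p98685) the crux is EQUIVALENT to the conclusion of the registered bet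
`stub_sparseSelection` — the route file's foreseen `FinalSliceSparsity` in ∃-form and WITHOUT moving
centres (`apexLocalisation_iff_sparse`):

  `ApexLocalisation ↔ ∀ C, (rate-Type-I singular slab profile with constant C exists) →`
  `  ∃ continuous singular class profile none of whose shell-centred Navier–Stokes images`
  `    λ_k u(λ_k² t, x_k + λ_k x) (λ_k ≤ ‖x_k‖ ≤ 2λ_k) converge in L³(Q(0,R)) (∀R) to an`
  `    origin-singular continuous class profile (𝐈 ≤ 4I', same rate)`.

(⇐) is the skeleton's composition: the ORBIT-CLOSURE DICHOTOMY `orbitDichotomy` (a continuous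
rate profile is apex by shell uniformity — `shellUniformityGivesApex'`, Disproof §9 re-proved — or
`stub_spherePersistence` turns the bad shell points into an origin-singular limit of shell-centred
images) applied to the selected profile (`apexLocalisation_of_sparse`); (⇒) is
`sparseSelection_of_apexLocalisation` (BetOptimality, p98706). The onion (`stub_onionShells`) is an
INPUT offered to the bet and is not needed for the equivalence.
-/

-- the summit and its single sub-problem share the name (CONVENTIONS §1), as in every Theorems file
set_option linter.dupNamespace false

namespace Summit.NavierStokesRegularity.NavierStokesRegularity.Theorems.RellichScarApexLocalisation

open MeasureTheory Set Function Metric Filter Topology TopologicalSpace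
open scoped ENNReal NNReal
open Literature.Analysis Literature.Analysis.FluidPDE
open Summit.NavierStokesRegularity.NavierStokesRegularity.Theses

local notation "E³" => EuclideanSpace ℝ (Fin 3)

/-! ### Glue A — shell uniformity of all zooms gives the apex bound (Disproof §9, re-proved) -/

/-- **Shell uniformity ⇒ apex** (the ideators' `ShellUniformityGivesApex`, proved in
`Cruxes/ApexLocalisation/Disproof.lean` §9; re-proved here because Theorems files may not import
Cruxes files): if `u` has the rate `C` and all zooms `λ u(λ² t, λ y)` are bounded by `θ⁻¹` on the
shell `1 ≤ ‖y‖ ≤ 2` during `(-θ², 0)`, then `u` has the space–time Type-I bound with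
`C' = (max C 0 + 1)(θ⁻¹ + 1)`. Inside the paraboloid `‖x‖ ≤ θ⁻¹ √(−t)` the rate suffices; outside,
the zoom `λ = ‖x‖` at `y = x/‖x‖`, `s = t/‖x‖²` lands on the shell at an admissible time. -/
theorem shellUniformityGivesApex' {u : ℝ → E³ → E³} {C θ : ℝ} (hθ : 0 < θ)
    (hrate : HasTypeITimeDecay C u)
    (hshell : ∀ lam : ℝ, 0 < lam → ∀ t : ℝ, -θ ^ 2 < t → t < 0 → ∀ y : E³, 1 ≤ ‖y‖ → ‖y‖ ≤ 2 →
      lam * ‖u (lam ^ 2 * t) (lam • y)‖ ≤ θ⁻¹) :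
    HasTypeIDecay ((max C 0 + 1) * (θ⁻¹ + 1)) u := by
  set K : ℝ := θ⁻¹ with hK
  have hK0 : 0 < K := inv_pos.2 hθ
  have hθK : θ * K = 1 := by rw [hK]; field_simp
  set C₀ : ℝ := max C 0 with hC₀
  have hC₀0 : 0 ≤ C₀ := le_max_right _ _
  have hCC₀ : C ≤ C₀ := le_max_left _ _
  intro t ht x
  have hst : 0 < Real.sqrt (-t) := Real.sqrt_pos.2 (by linarith)
  have hden : 0 < ‖x‖ + Real.sqrt (-t) := by positivity
  rw [le_div_iff₀ hden]
  by_cases hx : ‖x‖ ≤ K * Real.sqrt (-t)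
  · -- inside the paraboloid: the rate suffices
    have h1 : ‖u t x‖ ≤ C₀ / Real.sqrt (-t) :=
      (hrate t ht x).trans (div_le_div_of_nonneg_right hCC₀ hst.le)
    rw [le_div_iff₀ hst] at h1
    calc ‖u t x‖ * (‖x‖ + Real.sqrt (-t)) ≤ ‖u t x‖ * ((K + 1) * Real.sqrt (-t)) := by
          apply mul_le_mul_of_nonneg_left _ (norm_nonneg _)
          linarith
      _ = (‖u t x‖ * Real.sqrt (-t)) * (K + 1) := by ring
      _ ≤ C₀ * (K + 1) := mul_le_mul_of_nonneg_right h1 (by linarith)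
      _ ≤ (C₀ + 1) * (K + 1) := by nlinarith
  · -- outside: zoom λ = ‖x‖ onto the unit shell
    push Not at hx
    have hxpos : 0 < ‖x‖ := lt_of_le_of_lt (by positivity) hx
    set s : ℝ := t / ‖x‖ ^ 2 with hs
    set y : E³ := ‖x‖⁻¹ • x with hy
    have hy1 : ‖y‖ = 1 := by
      rw [hy, norm_smul, norm_inv, norm_norm, inv_mul_cancel₀ hxpos.ne']
    have hs0 : s < 0 := div_neg_of_neg_of_pos ht (by positivity)
    have h2 : Real.sqrt (-t) < θ * ‖x‖ := by
      have := mul_lt_mul_of_pos_left hx hθ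
      rwa [← mul_assoc, hθK, one_mul] at this
    have h3 : -t < (θ * ‖x‖) ^ 2 := by
      nlinarith [h2, hst.le, Real.sq_sqrt (show (0 : ℝ) ≤ -t by linarith)]
    have hsθ : -θ ^ 2 < s := by
      rw [hs, lt_div_iff₀ (by positivity)]
      nlinarith [h3]
    have key := hshell ‖x‖ hxpos s hsθ hs0 y (by rw [hy1]) (by rw [hy1]; norm_num)
    have e1 : ‖x‖ ^ 2 * s = t := by
      rw [hs]; field_simp
    have e2 : ‖x‖ • y = x := by
      rw [hy, smul_smul, mul_inv_cancel₀ hxpos.ne', one_smul]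
    rw [e1, e2] at key
    -- key : ‖x‖ * ‖u t x‖ ≤ θ⁻¹ = K
    have hsqrt_le : Real.sqrt (-t) * K ≤ ‖x‖ := by nlinarith [hx]
    calc ‖u t x‖ * (‖x‖ + Real.sqrt (-t))
        = ‖u t x‖ * ‖x‖ + ‖u t x‖ * Real.sqrt (-t) := by ring
      _ ≤ K + ‖u t x‖ * Real.sqrt (-t) := by nlinarith [key, norm_nonneg (u t x)]
      _ ≤ K + 1 := by
          have hu0 : 0 ≤ ‖u t x‖ := norm_nonneg _
          have h4 : ‖u t x‖ * Real.sqrt (-t) * K ≤ K := by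
            calc ‖u t x‖ * Real.sqrt (-t) * K = ‖u t x‖ * (Real.sqrt (-t) * K) := by ring
              _ ≤ ‖u t x‖ * ‖x‖ := mul_le_mul_of_nonneg_left hsqrt_le hu0
              _ = ‖x‖ * ‖u t x‖ := mul_comm _ _
              _ ≤ K := by simpa [hK] using key
          have h5 : ‖u t x‖ * Real.sqrt (-t) ≤ 1 := by
            by_contra hcon
            push Not at hcon
            have : K < ‖u t x‖ * Real.sqrt (-t) * K := by nlinarith
            linarith
          linarith
      _ ≤ (C₀ + 1) * (K + 1) := by nlinarith

/-! ### Glue B — the orbit-closure dichotomy (route: OrbitClosureDichotomy) -/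

/-- **Orbit-closure dichotomy** (the route file's foreseen `OrbitClosureDichotomy`, in a form
without moving centres): a continuous rate-Type-I suitable weak slab profile with `𝐈 ≤ I < ⊤` is
EITHER apex (`HasTypeIDecay C' u` for some `C'`), OR some sequence of its shell-centred
Navier–Stokes images `λ_k u(λ_k² t, x_k + λ_k x)` (`λ_k ≤ ‖x_k‖ ≤ 2λ_k`) converges in `L³(Q(0,R))`
(∀R) to a continuous rate-`C` class profile with `𝐈 ≤ 4I` that is SINGULAR AT THE ORIGIN. (If shell
uniformity fails for every `θ = 1/(n+1)`, the bad shell points give images blowing up at their own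
origin column at times `↑ 0`, and `stub_spherePersistence` applies.) -/
theorem orbitDichotomy {C : ℝ} {I : ℝ≥0∞} {u : ℝ → E³ → E³} {p : ℝ → E³ → ℝ}
    {G : ℝ → E³ → E³ →L[ℝ] E³} (hI : I < ⊤)
    (hsw : IsSuitableWeakSolutionOn (slab E³ (Iio 0) isOpen_Iio) 1 0 u p)
    (hwg : HasWeakSpatialGradientOn (slab E³ (Iio 0) isOpen_Iio) u G)
    (hIle : typeIBound (Iio (0 : ℝ) ×ˢ univ) u p G ≤ I)
    (hC : HasTypeITimeDecay C u)
    (hcont : ContinuousOn (uncurry u) (Iio (0 : ℝ) ×ˢ univ)) :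
    (∃ C' : ℝ, HasTypeIDecay C' u) ∨
    ∃ (lk : ℕ → ℝ) (xk : ℕ → E³) (v : ℝ → E³ → E³) (q : ℝ → E³ → ℝ) (H : ℝ → E³ → E³ →L[ℝ] E³),
      (∀ k, 0 < lk k ∧ lk k ≤ ‖xk k‖ ∧ ‖xk k‖ ≤ 2 * lk k) ∧
      IsSuitableWeakSolutionOn (slab E³ (Iio 0) isOpen_Iio) 1 0 v q ∧
      HasWeakSpatialGradientOn (slab E³ (Iio 0) isOpen_Iio) v H ∧
      typeIBound (Iio (0 : ℝ) ×ˢ univ) v q H ≤ 4 * I ∧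
      HasTypeITimeDecay C v ∧
      ContinuousOn (uncurry v) (Iio (0 : ℝ) ×ˢ univ) ∧
      (∀ R : ℝ, 0 < R → Tendsto (fun k => eLpNorm
        (uncurry (lk k • stPull (lk k ^ 2) (lk k) 0 (xk k) u) - uncurry v) 3
        (volume.restrict (parabolicCylinder R (0 : ℝ × E³)))) atTop (𝓝 0)) ∧
      IsBackwardSingularPoint v 0 := by
  by_cases hshell : ∃ θ : ℝ, 0 < θ ∧ ∀ lam : ℝ, 0 < lam → ∀ t : ℝ, -θ ^ 2 < t → t < 0 →
      ∀ y : E³, 1 ≤ ‖y‖ → ‖y‖ ≤ 2 → lam * ‖u (lam ^ 2 * t) (lam • y)‖ ≤ θ⁻¹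
  · obtain ⟨θ, hθ, h⟩ := hshell
    exact Or.inl ⟨_, shellUniformityGivesApex' hθ hC h⟩
  · right
    push Not at hshell
    -- bad shell points at resolution `θ = 1/(n+1)`
    have hbad : ∀ n : ℕ, ∃ lam : ℝ, 0 < lam ∧ ∃ t : ℝ, -(1 / ((n : ℝ) + 1)) ^ 2 < t ∧ t < 0 ∧
        ∃ y : E³, 1 ≤ ‖y‖ ∧ ‖y‖ ≤ 2 ∧ (1 / ((n : ℝ) + 1))⁻¹ < lam * ‖u (lam ^ 2 * t) (lam • y)‖ := by
      intro n
      obtain ⟨lam, hlam, t, ht1, ht2, y, hy1, hy2, hlt⟩ := hshell (1 / ((n : ℝ) + 1)) (by positivity)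
      exact ⟨lam, hlam, t, ht1, ht2, y, hy1, hy2, hlt⟩
    choose lam hlam t ht1 ht2 y hy1 hy2 hlt using hbad
    -- the images centred at `x_k = λ_k y_k`
    have htk0 : Tendsto t atTop (𝓝 0) := by
      have hlow : Tendsto (fun n : ℕ => -(1 / ((n : ℝ) + 1)) ^ 2) atTop (𝓝 0) := by
        have h1 : Tendsto (fun n : ℕ => (1 / ((n : ℝ) + 1))) atTop (𝓝 0) :=
          tendsto_one_div_add_atTop_nhds_zero_nat
        have : Tendsto (fun n : ℕ => -((1 / ((n : ℝ) + 1)) ^ 2)) atTop (𝓝 (-(0 ^ 2))) :=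
          (h1.pow 2).neg
        simpa [neg_pow_two] using this
      refine tendsto_of_tendsto_of_tendsto_of_le_of_le hlow tendsto_const_nhds
        (fun n => (ht1 n).le) (fun n => (ht2 n).le)
    have hblow : Tendsto (fun k => lam k * ‖u (lam k ^ 2 * t k) (lam k • y k)‖) atTop atTop := by
      refine tendsto_atTop_mono (fun n => (hlt n).le) ?_
      have : Tendsto (fun n : ℕ => ((n : ℝ) + 1)) atTop atTop :=
        tendsto_atTop_add_const_right _ 1 tendsto_natCast_atTop_atTop
      refine this.congr fun n => ?_
      rw [one_div, inv_inv]
    obtain ⟨σ, v, q, H, hσ, hv, hvg, hvI, hvC, hvcont, hvsing, hconv⟩ :=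
      stub_spherePersistence C I u p G lam (fun k => lam k • y k) t hI hsw hwg hIle hC hcont
        hlam ht2 htk0 hblow
    refine ⟨lam ∘ σ, fun k => lam (σ k) • y (σ k), v, q, H, fun k => ⟨hlam _, ?_, ?_⟩, hv, hvg, hvI,
      hvC, hvcont, fun R hR => hconv R hR, hvsing⟩
    · show lam (σ k) ≤ ‖lam (σ k) • y (σ k)‖
      rw [norm_smul, Real.norm_of_nonneg (hlam _).le]
      nlinarith [hy1 (σ k), hlam (σ k)]
    · show ‖lam (σ k) • y (σ k)‖ ≤ 2 * lam (σ k)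
      rw [norm_smul, Real.norm_of_nonneg (hlam _).le]
      nlinarith [hy2 (σ k), hlam (σ k)]

/-! ### The reduction and the equivalence -/

/-- **Sparse selection ⇒ crux** (the composition of skeleton v3 with its four known stubs landed,
the onion input being superfluous for the implication): if, for every `C`, a rate-Type-I singular
slab profile with constant `C` yields a continuous singular class profile none of whose shell-centred
image sequences has an origin-singular `L³_loc`-limit in the class, then `RellichScar.ApexLocalisation`
holds — the selected profile is apex by `orbitDichotomy`. -/
theorem apexLocalisation_of_sparse
    (hsparse :
    ∀ C : ℝ,
      (∃ (u : ℝ → E³ → E³) (p : ℝ → E³ → ℝ) (G : ℝ → E³ → E³ →L[ℝ] E³),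
        IsSuitableWeakSolutionOn (slab E³ (Iio 0) isOpen_Iio) 1 0 u p ∧
        HasWeakSpatialGradientOn (slab E³ (Iio 0) isOpen_Iio) u G ∧
        typeIBound (Iio (0 : ℝ) ×ˢ univ) u p G < ⊤ ∧
        HasTypeITimeDecay C u ∧ IsBackwardSingularPoint u 0) →
      ∃ (C' : ℝ) (I' : ℝ≥0∞) (u : ℝ → E³ → E³) (p : ℝ → E³ → ℝ) (G : ℝ → E³ → E³ →L[ℝ] E³),
        I' < ⊤ ∧
        IsSuitableWeakSolutionOn (slab E³ (Iio 0) isOpen_Iio) 1 0 u p ∧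
        HasWeakSpatialGradientOn (slab E³ (Iio 0) isOpen_Iio) u G ∧
        typeIBound (Iio (0 : ℝ) ×ˢ univ) u p G ≤ I' ∧
        HasTypeITimeDecay C' u ∧
        ContinuousOn (uncurry u) (Iio (0 : ℝ) ×ˢ univ) ∧
        IsBackwardSingularPoint u 0 ∧
        ∀ (lk : ℕ → ℝ) (xk : ℕ → E³) (v : ℝ → E³ → E³) (q : ℝ → E³ → ℝ)
          (H : ℝ → E³ → E³ →L[ℝ] E³),
          (∀ k, 0 < lk k ∧ lk k ≤ ‖xk k‖ ∧ ‖xk k‖ ≤ 2 * lk k) →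
          IsSuitableWeakSolutionOn (slab E³ (Iio 0) isOpen_Iio) 1 0 v q →
          HasWeakSpatialGradientOn (slab E³ (Iio 0) isOpen_Iio) v H →
          typeIBound (Iio (0 : ℝ) ×ˢ univ) v q H ≤ 4 * I' →
          HasTypeITimeDecay C' v →
          ContinuousOn (uncurry v) (Iio (0 : ℝ) ×ˢ univ) →
          (∀ R : ℝ, 0 < R → Tendsto (fun k => eLpNorm
            (uncurry (lk k • stPull (lk k ^ 2) (lk k) 0 (xk k) u) - uncurry v) 3
            (volume.restrict (parabolicCylinder R (0 : ℝ × E³)))) atTop (𝓝 0)) →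
          ¬ IsBackwardSingularPoint v 0) :
    RellichScar.ApexLocalisation := by
  intro C hant
  obtain ⟨C', I', u, p, G, hI', hsw, hwg, hIle, hC', hcont, hsing, hsp⟩ := hsparse C hant
  rcases orbitDichotomy hI' hsw hwg hIle hC' hcont with ⟨C'', hdec⟩ |
    ⟨lk, xk, v, q, H, hadm, hv, hvg, hvI, hvC, hvcont, hconv, hvsing⟩
  · exact ⟨C'', u, p, G, hsw, hwg, lt_of_le_of_lt hIle hI', hdec, hsing⟩
  · exact absurd hvsing (hsp lk xk v q H hadm hv hvg hvI hvC hvcont hconv)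

/-- **Crux ⇔ final-slice sparsity (∃-form, profile side, no moving centres).** -/
theorem apexLocalisation_iff_sparse :
    RellichScar.ApexLocalisation ↔
    ∀ C : ℝ,
      (∃ (u : ℝ → E³ → E³) (p : ℝ → E³ → ℝ) (G : ℝ → E³ → E³ →L[ℝ] E³),
        IsSuitableWeakSolutionOn (slab E³ (Iio 0) isOpen_Iio) 1 0 u p ∧
        HasWeakSpatialGradientOn (slab E³ (Iio 0) isOpen_Iio) u G ∧
        typeIBound (Iio (0 : ℝ) ×ˢ univ) u p G < ⊤ ∧
        HasTypeITimeDecay C u ∧ IsBackwardSingularPoint u 0) →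
      ∃ (C' : ℝ) (I' : ℝ≥0∞) (u : ℝ → E³ → E³) (p : ℝ → E³ → ℝ) (G : ℝ → E³ → E³ →L[ℝ] E³),
        I' < ⊤ ∧
        IsSuitableWeakSolutionOn (slab E³ (Iio 0) isOpen_Iio) 1 0 u p ∧
        HasWeakSpatialGradientOn (slab E³ (Iio 0) isOpen_Iio) u G ∧
        typeIBound (Iio (0 : ℝ) ×ˢ univ) u p G ≤ I' ∧
        HasTypeITimeDecay C' u ∧
        ContinuousOn (uncurry u) (Iio (0 : ℝ) ×ˢ univ) ∧
        IsBackwardSingularPoint u 0 ∧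
        ∀ (lk : ℕ → ℝ) (xk : ℕ → E³) (v : ℝ → E³ → E³) (q : ℝ → E³ → ℝ)
          (H : ℝ → E³ → E³ →L[ℝ] E³),
          (∀ k, 0 < lk k ∧ lk k ≤ ‖xk k‖ ∧ ‖xk k‖ ≤ 2 * lk k) →
          IsSuitableWeakSolutionOn (slab E³ (Iio 0) isOpen_Iio) 1 0 v q →
          HasWeakSpatialGradientOn (slab E³ (Iio 0) isOpen_Iio) v H →
          typeIBound (Iio (0 : ℝ) ×ˢ univ) v q H ≤ 4 * I' →
          HasTypeITimeDecay C' v →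
          ContinuousOn (uncurry v) (Iio (0 : ℝ) ×ˢ univ) →
          (∀ R : ℝ, 0 < R → Tendsto (fun k => eLpNorm
            (uncurry (lk k • stPull (lk k ^ 2) (lk k) 0 (xk k) u) - uncurry v) 3
            (volume.restrict (parabolicCylinder R (0 : ℝ × E³)))) atTop (𝓝 0)) →
          ¬ IsBackwardSingularPoint v 0 :=
  ⟨fun h C hant => sparseSelection_of_apexLocalisation h C hant, apexLocalisation_of_sparse⟩

end Summit.NavierStokesRegularity.NavierStokesRegularity.Theorems.RellichScarApexLocalisation
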